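import Mathlib.RingTheory.Nakayama
import Mathlib.RingTheory.LocalRing.MaximalIdeal.Basic
import Mathlib.RingTheory.LocalRing.ResidueField.Basic
import Mathlib.RingTheory.Noetherian.Basic
import Mathlib.RingTheory.RegularLocalRing.Defs
import Mathlib.LinearAlgebra.FiniteDimensional.Lemmas
import HarnessLib

/-!
# Jets spanning `𝒪/𝔪²` make the ratios generate the maximal ideal (Nakayama)

Topic: `Literature/AlgebraicGeometry/Resolution`. The local algebra behind "the projection
`(t₀ : … : t_d)` restricted to `Z` is unramified at `z` when the differentials of the `tₐ` at `z`
span the cotangent space" (de Jong 1996, 2.11 (β) / proof of 4.11: "`Z → π(Z) → ℙ^{d-1}` is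
generically étale by construction"): for a Noetherian local `k`-algebra `B` with residue field
`k`, an ideal `I ⊆ 𝔪_B` and elements `s₀, …, s_d ∈ B` with `s_{i₀}` a unit whose classes span
`B/(I + 𝔪_B²)` over `k`, the elements `sₐ/s_{i₀} - λₐ` (`λₐ ∈ k` their residue values) generate
`𝔪_B` modulo `I` (`BertiniAffine.span_ratio_sub_sup_eq_maximalIdeal`); and the count that makes a
generic choice of `d + 1` jets span: **`dim_k R/𝔪_R² = dim R + 1` for a regular local
`k`-algebra `R` with residue field `k`** (`BertiniAffine.finrank_quotient_maximalIdeal_sq_of_isRegularLocalRing`,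
the local form of `BertiniAffine.finrank_quotient_sq`).

Everything is proved; no named facts.

## References

* A. J. de Jong, *Smoothness, semi-stability and alterations*, Publ. Math. IHÉS 83 (1996), 2.11
  and proof of 4.11 (p. 68). [DeJong1996]
* H. Matsumura, *Commutative Ring Theory* (1986), Thm. 2.2 (Nakayama). [Matsumura1987]
-/

namespace Literature.AlgebraicGeometry.Resolution

namespace BertiniAffine

open IsLocalRing

universe u v

variable {k : Type u} [Field k] {B : Type v} [CommRing B] [IsLocalRing B] [IsNoetherianRing B]
  [Algebra k B]

/-- **Nakayama for jets.** Let `B` be a Noetherian local `k`-algebra, `I ⊆ 𝔪_B`, and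
`s : Fin (d + 1) → B` with `s i₀` a unit, whose classes span `B/(I + 𝔪_B²)` as a `k`-vector space.
If `λₐ ∈ k` are the residue values of the ratios `sₐ / s_{i₀}` (i.e. `sₐ/s_{i₀} - λₐ ∈ 𝔪_B`), then
the ideal generated by the `sₐ/s_{i₀} - λₐ`, together with `I`, is `𝔪_B`. [cite: Matsumura1987, Thm. 2.2]
[cite: DeJong1996, 2.11] -/
theorem span_ratio_sub_sup_eq_maximalIdeal {d : ℕ} (I : Ideal B) (hI : I ≤ maximalIdeal B)
    (s : Fin (d + 1) → B) {i₀ : Fin (d + 1)} (hu : IsUnit (s i₀))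
    (hspan : Submodule.span k (Set.range fun a =>
      Ideal.Quotient.mk (I ⊔ maximalIdeal B ^ 2) (s a)) = ⊤)
    (lam : Fin (d + 1) → k) (hlam : ∀ a, s a * ↑hu.unit⁻¹ - algebraMap k B (lam a) ∈ maximalIdeal B) :
    Ideal.span (Set.range fun a => s a * ↑hu.unit⁻¹ - algebraMap k B (lam a)) ⊔ I =
      maximalIdeal B := by
  set E := Ideal.span (Set.range fun a => s a * ↑hu.unit⁻¹ - algebraMap k B (lam a)) with hE
  have hrw : ∀ a, s a - algebraMap k B (lam a) * s i₀ =
      (s a * ↑hu.unit⁻¹ - algebraMap k B (lam a)) * s i₀ := fun a => by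
    rw [sub_mul, mul_assoc, IsUnit.val_inv_mul, mul_one]
  -- the elements `eₐ = sₐ - λₐ s_{i₀}` lie in `E` and in `𝔪`
  have he : ∀ a, s a - algebraMap k B (lam a) * s i₀ ∈ E := fun a => by
    rw [hrw]
    exact Ideal.mul_mem_right _ _ (Ideal.subset_span ⟨a, rfl⟩)
  have hem : ∀ a, s a - algebraMap k B (lam a) * s i₀ ∈ maximalIdeal B := fun a => by
    rw [hrw]
    exact Ideal.mul_mem_right _ _ (hlam a)
  apply le_antisymm
  · refine sup_le (Ideal.span_le.mpr ?_) hI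
    rintro _ ⟨a, rfl⟩
    exact hlam a
  -- Nakayama: `𝔪 ≤ (E ⊔ I) ⊔ 𝔪 • 𝔪`
  have hfg : (maximalIdeal B).FG := (isNoetherianRing_iff_ideal_fg B).mp inferInstance _
  refine Submodule.le_of_le_smul_of_le_jacobson_bot hfg (maximalIdeal_le_jacobson ⊥) fun m hm => ?_
  -- write `m ≡ Σ cₐ sₐ` modulo `I + 𝔪²`
  have hmem : Ideal.Quotient.mk (I ⊔ maximalIdeal B ^ 2) m ∈
      Submodule.span k (Set.range fun a => Ideal.Quotient.mk (I ⊔ maximalIdeal B ^ 2) (s a)) := by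
    rw [hspan]; exact Submodule.mem_top
  obtain ⟨c, hc⟩ := (Submodule.mem_span_range_iff_exists_fun k).mp hmem
  -- so `m - Σ cₐ sₐ ∈ I + 𝔪²`
  have hdiff : m - ∑ a, algebraMap k B (c a) * s a ∈ I ⊔ maximalIdeal B ^ 2 := by
    rw [← Ideal.Quotient.eq_zero_iff_mem, map_sub, map_sum, sub_eq_zero, ← hc]
    refine Finset.sum_congr rfl fun a _ => ?_
    rw [map_mul, Algebra.smul_def]
    rfl
  -- `Σ cₐ sₐ = Σ cₐ eₐ + (Σ cₐ λₐ) s_{i₀}`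
  have hsum : ∑ a, algebraMap k B (c a) * s a =
      ∑ a, algebraMap k B (c a) * (s a - algebraMap k B (lam a) * s i₀) +
        algebraMap k B (∑ a, c a * lam a) * s i₀ := by
    rw [map_sum, Finset.sum_mul, ← Finset.sum_add_distrib]
    refine Finset.sum_congr rfl fun a _ => ?_
    rw [map_mul]; ring
  -- the scalar `μ = Σ cₐ λₐ` vanishes: `μ s_{i₀} ∈ 𝔪` with `s_{i₀}` a unit forces `μ = 0`
  set μ := ∑ a, c a * lam a with hμ
  have hμs : algebraMap k B μ * s i₀ ∈ maximalIdeal B := by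
    have h1 : ∑ a, algebraMap k B (c a) * (s a - algebraMap k B (lam a) * s i₀) ∈ maximalIdeal B :=
      Submodule.sum_mem _ fun a _ => Ideal.mul_mem_left _ _ (hem a)
    have h2 : ∑ a, algebraMap k B (c a) * s a ∈ maximalIdeal B := by
      have h3 : m - ∑ a, algebraMap k B (c a) * s a ∈ maximalIdeal B :=
        (sup_le hI (Ideal.pow_le_self two_ne_zero)) hdiff
      have := Ideal.sub_mem _ hm h3
      rwa [sub_sub_cancel] at this
    rw [hsum] at h2
    have := Ideal.sub_mem _ h2 h1
    rwa [add_sub_cancel_left] at this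
  have hμ0 : μ = 0 := by
    by_contra hne
    have hunit : IsUnit (algebraMap k B μ * s i₀) :=
      ((IsUnit.mk0 μ hne).map (algebraMap k B)).mul hu
    exact (mem_maximalIdeal _).mp hμs hunit
  -- conclude: `m ∈ (E ⊔ I) ⊔ 𝔪 • 𝔪`
  have hm' : m = (∑ a, algebraMap k B (c a) * (s a - algebraMap k B (lam a) * s i₀)) +
      (m - ∑ a, algebraMap k B (c a) * s a) := by
    rw [hsum, hμ0, map_zero, zero_mul, add_zero, add_sub_cancel]
  rw [hm']
  refine Submodule.add_mem _ ?_ ?_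
  · exact Submodule.mem_sup_left (Submodule.mem_sup_left
      (Submodule.sum_mem _ fun a _ => Ideal.mul_mem_left _ _ (he a)))
  · have : I ⊔ maximalIdeal B ^ 2 ≤ (E ⊔ I) ⊔ maximalIdeal B • maximalIdeal B := by
      refine sup_le (le_sup_left.trans' le_sup_right) ?_
      rw [pow_two, ← Ideal.smul_eq_mul]
      exact le_sup_right
    exact this hdiff

/-! ## Counting jets: `dim_k R/𝔪² = dim R + 1` for a regular local `k`-algebra with residue field `k` -/

section Count

variable {R : Type v} [CommRing R] [Algebra k R]

omit [IsLocalRing B] [IsNoetherianRing B] in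
/-- The `k`-action on the cotangent space of a local `k`-algebra factors through its residue
field. [folklore] -/
theorem isScalarTower_residueField_cotangentSpace' [IsLocalRing R] :
    IsScalarTower k (ResidueField R) (CotangentSpace R) := by
  refine ⟨fun c x v => ?_⟩
  obtain ⟨r, rfl⟩ := IsLocalRing.residue_surjective x
  have h2 : ∀ r : R, (IsLocalRing.residue R r) • v = r • v :=
    fun r => algebraMap_smul (ResidueField R) r v
  have h1 : c • IsLocalRing.residue R r = IsLocalRing.residue R (c • r) := by
    rw [Algebra.smul_def, Algebra.smul_def, map_mul, IsScalarTower.algebraMap_apply k R]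
    rfl
  rw [h1, h2, h2, smul_assoc]

omit [IsLocalRing B] [IsNoetherianRing B] in
/-- **`dim_k (R ⧸ 𝔪²) = dim R + 1`, and `R ⧸ 𝔪²` is finite over `k`**, for a regular local
`k`-algebra `R` whose residue field is `k` (`k → κ(R)` bijective): `R ⧸ 𝔪²` is an extension of
`κ(R) = k` by the cotangent space `𝔪 ⧸ 𝔪²`, of dimension `dim R` by regularity.
[cite: Matsumura1987, §14 (regular local rings)] -/
theorem finrank_quotient_maximalIdeal_sq_of_isRegularLocalRing [IsRegularLocalRing R]
    (hbij : Function.Bijective (algebraMap k (ResidueField R))) {n : ℕ} (hn : ringKrullDim R = n) :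
    Module.Finite k (R ⧸ maximalIdeal R ^ 2) ∧ Module.finrank k (R ⧸ maximalIdeal R ^ 2) = n + 1 := by
  let κ := ResidueField R
  -- `dim_κ 𝔪/𝔪² = n` by regularity
  have h1 : Module.finrank κ (CotangentSpace R) = n := by
    have h := (IsRegularLocalRing.iff_finrank_cotangentSpace R).1 inferInstance
    rw [hn] at h
    exact_mod_cast h
  -- `k = κ`
  let eκ : k ≃ₗ[k] κ := LinearEquiv.ofBijective (Algebra.linearMap k κ) hbij
  have hk1 : Module.finrank k κ = 1 := by rw [← eκ.finrank_eq, Module.finrank_self]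
  haveI : Module.Finite k κ := Module.Finite.equiv eκ
  haveI := isScalarTower_residueField_cotangentSpace' (k := k) (R := R)
  haveI : Module.Finite k (CotangentSpace R) := Module.Finite.trans κ (CotangentSpace R)
  have h2 : Module.finrank k (CotangentSpace R) = n := by
    rw [← Module.finrank_mul_finrank k κ (CotangentSpace R), hk1, h1, one_mul]
  -- `R ⧸ 𝔪² → κ`, whose kernel is `𝔪 ⧸ 𝔪²`
  have hle : maximalIdeal R ^ 2 ≤ maximalIdeal R := Ideal.pow_le_self two_ne_zero
  let π : (R ⧸ maximalIdeal R ^ 2) →ₐ[R] κ := Ideal.Quotient.factorₐ R hle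
  have hπs : Function.Surjective π := Ideal.Quotient.factor_surjective hle
  let πk : (R ⧸ maximalIdeal R ^ 2) →ₗ[k] κ := π.toLinearMap.restrictScalars k
  have hπk : ∀ x, πk x = π x := fun _ => rfl
  let j : CotangentSpace R →ₗ[k] R ⧸ maximalIdeal R ^ 2 :=
    ((maximalIdeal R).cotangentToQuotientSquare).restrictScalars k
  have hjinj : Function.Injective j := (maximalIdeal R).cotangentToQuotientSquare_injective
  have hπmk : ∀ z : R, π (Ideal.Quotient.mk _ z) = Ideal.Quotient.mk _ z := fun _ => rfl
  have hker : LinearMap.range j = LinearMap.ker πk := by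
    ext x
    constructor
    · rintro ⟨v, rfl⟩
      obtain ⟨y, rfl⟩ := (maximalIdeal R).toCotangent_surjective v
      rw [LinearMap.mem_ker, hπk]
      change π ((maximalIdeal R).cotangentToQuotientSquare ((maximalIdeal R).toCotangent y)) = 0
      rw [Ideal.toCotangent_to_quotient_square]
      change π (Ideal.Quotient.mk _ (y : R)) = 0
      rw [hπmk]
      exact Ideal.Quotient.eq_zero_iff_mem.2 y.2
    · intro hx
      obtain ⟨z, rfl⟩ := Ideal.Quotient.mk_surjective x
      rw [LinearMap.mem_ker, hπk, hπmk] at hx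
      have hz : z ∈ maximalIdeal R := Ideal.Quotient.eq_zero_iff_mem.1 hx
      refine ⟨(maximalIdeal R).toCotangent ⟨z, hz⟩, ?_⟩
      exact (maximalIdeal R).toCotangent_to_quotient_square ⟨z, hz⟩
  -- finiteness: kernel and image are finite over `k`
  haveI hfin : Module.Finite k (R ⧸ maximalIdeal R ^ 2) := by
    refine Module.finite_def.mpr (Submodule.fg_of_fg_map_of_fg_inf_ker πk ?_ ?_)
    · exact IsNoetherian.noetherian _
    · rw [top_inf_eq, ← hker, LinearMap.range_eq_map]
      exact (Module.finite_def.mp inferInstance).map j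
  refine ⟨hfin, ?_⟩
  have hrn := LinearMap.finrank_range_add_finrank_ker πk
  have hrange : Module.finrank k (LinearMap.range πk) = 1 := by
    rw [LinearMap.range_eq_top.2 (fun y => hπs y), finrank_top, hk1]
  have hkerdim : Module.finrank k (LinearMap.ker πk) = n := by
    rw [← hker, LinearMap.finrank_range_of_inj hjinj, h2]
  rw [hrange, hkerdim] at hrn
  omega

end Count

end BertiniAffine

end Literature.AlgebraicGeometry.Resolution
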